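import Summits.AtomisticToContinuum.FouriersLaw.Theorems.BondHeatUncertaintyBoundedResponseBathHeatHeatReturnB
import HarnessLib


/-!
# BondHeatUncertainty / BoundedResponse — «HorizonReturn» §1–§2: 1-D toolkit and the CONFINEMENT LEMMA for the thermal crossing defect
(decomp-a2c lens-1, g112, NODE 112 «HorizonReturn»; part 1 of 5 — the overview, tags, barriers and failure modes are in the main file
`…BathHeatHorizonReturn`, which imports this chain A → B → C → D → main)

§1 elementary integral inequalities over an arbitrary measure space: `f·g ∈ L¹` from `f², g² ∈ L¹`; Jensen `(∫f)² ≤ ∫f²` on a probability space;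
Cauchy–Schwarz `(∫fg)² ≤ ∫f²·∫g²`; the weighted AM–GM `|x||y| ≤ (l x² + y²/l)/2`.
§2 the thermal Gaussian `ν_T = N(0,T)`: integrable powers, positive mass of `[a,b]`, the thermal windows `S± = {k : ±k ≥ 0, T ≤ k² ≤ 4T}`, and
★ the CONFINEMENT LEMMA `thermalCrossDefect_le_of_monotoneSqOn`: if `g ∈ L²(ν_T)` is nondecreasing in `k²` on `k² ≤ κ²` (`κ² ≥ 4T`) then NODE 111's
crossing defect obeys `𝔇_T(g) ≤ A_{T,j}·(κ²)^{−j}·(1 + ∫ g² dν_T)` for every `j ∈ ℕ` (comparison curve: `g` frozen at `g(±κ)` beyond the radius —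
single-crossing admissible; the tail is paid by Gaussian moments). Pure 1-D; no chain. No `sorry`, no new axioms.
-/

noncomputable section

open MeasureTheory ProbabilityTheory Filter Topology Set Function
open scoped NNReal ENNReal
open Literature.MathematicalPhysics.KineticTheory.HeatConduction
open Literature.MathematicalPhysics.KineticTheory OscillatorChain
open Literature.Probability.Process
open Summit.AtomisticToContinuum.FouriersLaw.Theorems.OddSectorIrreversibility
  (pinnedChain_stronglyMeasurable_act_uncurry pinnedChain_integral_sq_act_le_of_stronglyMeasurable
    pinnedChain_integrable_transitionKernel_of_abs_le integral_exp_neg_mul_Ioi' integrable_mul_of_integrable_sq)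
open Summit.AtomisticToContinuum.FouriersLaw.Theorems.BoundedResponse.ParityFloor
  (kinObs kinAct continuous_kinObs abs_kinObs_le stronglyMeasurable_kinAct abs_kinAct_le kinAct_integrableOn
    harrisBound_exists weight_facts kinObs_sq_facts)

namespace Summit.AtomisticToContinuum.FouriersLaw.Theorems.BoundedResponse.HeatSpreading

/-! ## §1 Elementary integral inequalities (Jensen, Cauchy–Schwarz, weighted AM–GM) -/

/-- `f·g ∈ L¹` when `f², g² ∈ L¹` (any measure space). [folklore] -/
theorem integrable_mul_of_sq_sq {Ω : Type*} [MeasurableSpace Ω] {μ : Measure Ω} {f g : Ω → ℝ}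
    (hf : AEStronglyMeasurable f μ) (hg : AEStronglyMeasurable g μ) (hf2 : Integrable (fun y => f y ^ 2) μ)
    (hg2 : Integrable (fun y => g y ^ 2) μ) : Integrable (fun y => f y * g y) μ := by
  refine (hf2.add hg2).mono' (hf.mul hg) (Eventually.of_forall fun y => ?_)
  rw [Real.norm_eq_abs, abs_mul, Pi.add_apply]
  nlinarith [sq_nonneg (|f y| - |g y|), sq_abs (f y), sq_abs (g y), abs_nonneg (f y), abs_nonneg (g y)]

/-- **Jensen**: `(∫ f dP)² ≤ ∫ f² dP` on a probability space (the variance is nonnegative). [folklore] -/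
theorem sq_integral_le_integral_sq_of_prob {Ω : Type*} [MeasurableSpace Ω] {P : Measure Ω} [IsProbabilityMeasure P]
    {f : Ω → ℝ} (hfm : AEStronglyMeasurable f P) (hf2 : Integrable (fun x => f x ^ 2) P) :
    (∫ x, f x ∂P) ^ 2 ≤ ∫ x, f x ^ 2 ∂P := by
  have hmem : MemLp f 2 P := (memLp_two_iff_integrable_sq hfm).2 hf2
  have h1 := variance_eq_sub hmem
  have h2 := variance_nonneg f P
  have h3 : P[f ^ 2] = ∫ x, f x ^ 2 ∂P := rfl
  linarith

/-- **Cauchy–Schwarz**: `(∫ f·g)² ≤ (∫ f²)·(∫ g²)` for `f², g² ∈ L¹` (any measure). [folklore] -/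
theorem sq_integral_mul_le_integral_sq_mul {Ω : Type*} [MeasurableSpace Ω] {μ : Measure Ω} {f g : Ω → ℝ}
    (hfm : AEStronglyMeasurable f μ) (hgm : AEStronglyMeasurable g μ)
    (hf2 : Integrable (fun x => f x ^ 2) μ) (hg2 : Integrable (fun x => g x ^ 2) μ) :
    (∫ x, f x * g x ∂μ) ^ 2 ≤ (∫ x, f x ^ 2 ∂μ) * ∫ x, g x ^ 2 ∂μ := by
  have hfg : Integrable (fun x => f x * g x) μ := integrable_mul_of_sq_sq hfm hgm hf2 hg2
  have hA0 : 0 ≤ ∫ x, f x ^ 2 ∂μ := integral_nonneg fun x => sq_nonneg _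
  have hB0 : 0 ≤ ∫ x, g x ^ 2 ∂μ := integral_nonneg fun x => sq_nonneg _
  -- the quadratic family `0 ≤ A − 2λC + λ²B`
  have key : ∀ l : ℝ, 0 ≤ (∫ x, f x ^ 2 ∂μ) - 2 * l * (∫ x, f x * g x ∂μ) + l ^ 2 * ∫ x, g x ^ 2 ∂μ := by
    intro l
    have h1 : Integrable (fun x => f x ^ 2 - 2 * l * (f x * g x)) μ := hf2.sub (hfg.const_mul _)
    have h2 : Integrable (fun x => l ^ 2 * g x ^ 2) μ := hg2.const_mul _
    have h3 : Integrable (fun x => 2 * l * (f x * g x)) μ := hfg.const_mul _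
    have h0 : 0 ≤ ∫ x, (f x - l * g x) ^ 2 ∂μ := integral_nonneg fun x => sq_nonneg _
    have e1 : ∫ x, (f x - l * g x) ^ 2 ∂μ = ∫ x, (f x ^ 2 - 2 * l * (f x * g x)) + l ^ 2 * g x ^ 2 ∂μ :=
      integral_congr_ae (Eventually.of_forall fun x => by simp only; ring)
    rw [e1, integral_add h1 h2, integral_sub hf2 h3, integral_const_mul, integral_const_mul] at h0
    exact h0
  by_cases hB : ∫ x, g x ^ 2 ∂μ = 0
  · -- then `∫ f g = 0`
    have hC0 : ∫ x, f x * g x ∂μ = 0 := by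
      by_contra hne
      have h := key (((∫ x, f x ^ 2 ∂μ) + 1) / (2 * ∫ x, f x * g x ∂μ))
      have e : 2 * (((∫ x, f x ^ 2 ∂μ) + 1) / (2 * ∫ x, f x * g x ∂μ)) * (∫ x, f x * g x ∂μ) =
          (∫ x, f x ^ 2 ∂μ) + 1 := by
        field_simp
      rw [hB, mul_zero, add_zero, e] at h
      linarith
    rw [hC0, hB]; simp
  · have hBpos : 0 < ∫ x, g x ^ 2 ∂μ := lt_of_le_of_ne hB0 (Ne.symm hB)
    have h := key ((∫ x, f x * g x ∂μ) / ∫ x, g x ^ 2 ∂μ)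
    have e : (∫ x, f x ^ 2 ∂μ) - 2 * ((∫ x, f x * g x ∂μ) / ∫ x, g x ^ 2 ∂μ) * (∫ x, f x * g x ∂μ) +
        ((∫ x, f x * g x ∂μ) / ∫ x, g x ^ 2 ∂μ) ^ 2 * (∫ x, g x ^ 2 ∂μ) =
        (∫ x, f x ^ 2 ∂μ) - (∫ x, f x * g x ∂μ) ^ 2 / ∫ x, g x ^ 2 ∂μ := by
      field_simp; ring
    rw [e] at h
    have : (∫ x, f x * g x ∂μ) ^ 2 / (∫ x, g x ^ 2 ∂μ) ≤ ∫ x, f x ^ 2 ∂μ := by linarith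
    rwa [div_le_iff₀ hBpos] at this

/-- Weighted AM–GM: `|x|·|y| ≤ (λx² + y²/λ)/2` for `λ > 0`. [folklore] -/
theorem abs_mul_abs_le_weighted {x y l : ℝ} (hl : 0 < l) : |x| * |y| ≤ (l * x ^ 2 + y ^ 2 / l) / 2 := by
  have h : 0 ≤ (l * |x| - |y|) ^ 2 / l := div_nonneg (sq_nonneg _) hl.le
  have e : (l * |x| - |y|) ^ 2 / l = l * x ^ 2 + y ^ 2 / l - 2 * (|x| * |y|) := by
    field_simp
    rw [← sq_abs x, ← sq_abs y]; ring
  linarith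

/-! ## §2 The 1-D thermal Gaussian `ν_T = N(0,T)`: moments, interval masses, and the CONFINEMENT LEMMA -/

/-- Polynomial moments of `ν_T` (tree: `lightCone_integrable_pow_gaussianReal`). [folklore]  (Landing lane, hand-2 g40: `private` — dedup token; the
alias restates the tree lemma and is used only inside this file.) -/
private theorem gaussT_integrable_pow' (T : ℝ) (m : ℕ) : Integrable (fun k : ℝ => k ^ m) (gaussianReal 0 T.toNNReal) :=
  PhononMeanFreePath.lightCone_integrable_pow_gaussianReal T m

/-- The two moment functions of the confinement lemma are `ν_T`-integrable:
`(k² − T)²·(k²)^{2j}` and `(k² + T)·(k²)^j`. [folklore] -/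
theorem gaussT_integrable_confinementMoments (T : ℝ) (j : ℕ) :
    Integrable (fun k : ℝ => (k ^ 2 - T) ^ 2 * (k ^ 2) ^ (2 * j)) (gaussianReal 0 T.toNNReal) ∧
      Integrable (fun k : ℝ => (k ^ 2 + T) * (k ^ 2) ^ j) (gaussianReal 0 T.toNNReal) := by
  have hp := gaussT_integrable_pow' T
  constructor
  · have e : (fun k : ℝ => (k ^ 2 - T) ^ 2 * (k ^ 2) ^ (2 * j)) =
        fun k => (k ^ (4 * j + 4) - 2 * T * k ^ (4 * j + 2)) + T ^ 2 * k ^ (4 * j) := by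
      funext k; ring
    rw [e]
    have h1 : Integrable (fun k : ℝ => k ^ (4 * j + 4) - 2 * T * k ^ (4 * j + 2)) (gaussianReal 0 T.toNNReal) :=
      (hp _).sub ((hp _).const_mul _)
    exact h1.add ((hp _).const_mul _)
  · have e : (fun k : ℝ => (k ^ 2 + T) * (k ^ 2) ^ j) = fun k => k ^ (2 * j + 2) + T * k ^ (2 * j) := by
      funext k; ring
    rw [e]
    exact (hp _).add ((hp _).const_mul _)

/-- `ν_T` charges every nondegenerate interval (`T > 0`; Lebesgue `≪ ν_T`). [folklore] -/
theorem gaussT_measureReal_Icc_pos {T : ℝ} (hT : 0 < T) {a b : ℝ} (hab : a < b) :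
    0 < (gaussianReal 0 T.toNNReal).real (Icc a b) := by
  have hv : T.toNNReal ≠ 0 := by
    rw [Ne, Real.toNNReal_eq_zero]; exact not_le.2 hT
  have hac := gaussianReal_absolutelyContinuous' (0 : ℝ) hv
  have hvol : volume (Icc a b) ≠ 0 := by
    rw [Real.volume_Icc]; exact (ENNReal.ofReal_pos.2 (by linarith)).ne'
  have hne : gaussianReal 0 T.toNNReal (Icc a b) ≠ 0 := fun h => hvol (hac h)
  exact ENNReal.toReal_pos hne (measure_ne_top _ _)

/-- The thermal window mass `p_T = min(ν_T[√T, 2√T], ν_T[0, √T]) > 0` used to control the crossing level. [this cell] -/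
def gaussTWindow (T : ℝ) : ℝ :=
  min ((gaussianReal 0 T.toNNReal).real (Icc (Real.sqrt T) (2 * Real.sqrt T)))
    ((gaussianReal 0 T.toNNReal).real (Icc 0 (Real.sqrt T)))

/-- `gaussTWindow_pos` (docstring added by the landing lane; see the module docstring). [formal bookkeeping] -/
theorem gaussTWindow_pos {T : ℝ} (hT : 0 < T) : 0 < gaussTWindow T := by
  have hsT : 0 < Real.sqrt T := Real.sqrt_pos.2 hT
  exact lt_min (gaussT_measureReal_Icc_pos hT (by linarith)) (gaussT_measureReal_Icc_pos hT hsT)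

/-- Crossing-level control: if `g ∈ L²(ν_T)` is nondecreasing in `k²` on `k² ≤ κ²` with `κ² ≥ 4T`, then
`|g(√T)| · p_T ≤ (1 + ‖g‖₂²)/2` (average `g` over `[√T, 2√T]` resp. `[0, √T]`, where it dominates resp. is dominated by `g(√T)`). [this cell] -/
theorem abs_crossLevel_mul_window_le {T : ℝ} (hT : 0 < T) {κ : ℝ} {g : ℝ → ℝ} (hκ : 4 * T ≤ κ ^ 2)
    (hgm : AEStronglyMeasurable g (gaussianReal 0 T.toNNReal))
    (hg2 : Integrable (fun k => g k ^ 2) (gaussianReal 0 T.toNNReal))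
    (hmono : ∀ k₁ k₂ : ℝ, k₁ ^ 2 ≤ k₂ ^ 2 → k₂ ^ 2 ≤ κ ^ 2 → g k₁ ≤ g k₂) :
    |g (Real.sqrt T)| * gaussTWindow T ≤ (1 + ∫ k, g k ^ 2 ∂(gaussianReal 0 T.toNNReal)) / 2 := by
  have hsT : 0 < Real.sqrt T := Real.sqrt_pos.2 hT
  have hsT2 : Real.sqrt T ^ 2 = T := Real.sq_sqrt hT.le
  have hp0 := gaussTWindow_pos hT
  have hI0 : 0 ≤ ∫ k, g k ^ 2 ∂(gaussianReal 0 T.toNNReal) := integral_nonneg fun k => sq_nonneg _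
  have hgi : Integrable g (gaussianReal 0 T.toNNReal) :=
    ((memLp_two_iff_integrable_sq hgm).2 hg2).integrable one_le_two
  have hhalf : ∀ k, g k ≤ (1 + g k ^ 2) / 2 := fun k => by nlinarith [sq_nonneg (g k - 1)]
  have hhalf' : ∀ k, -g k ≤ (1 + g k ^ 2) / 2 := fun k => by nlinarith [sq_nonneg (g k + 1)]
  have hhi : Integrable (fun k => (1 + g k ^ 2) / 2) (gaussianReal 0 T.toNNReal) :=
    ((integrable_const _).add hg2).div_const 2
  have hset : ∀ S : Set ℝ, ∫ k in S, (1 + g k ^ 2) / 2 ∂(gaussianReal 0 T.toNNReal) ≤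
      (1 + ∫ k, g k ^ 2 ∂(gaussianReal 0 T.toNNReal)) / 2 := by
    intro S
    have h1 : ∫ k in S, (1 + g k ^ 2) / 2 ∂(gaussianReal 0 T.toNNReal) ≤
        ∫ k, (1 + g k ^ 2) / 2 ∂(gaussianReal 0 T.toNNReal) :=
      setIntegral_le_integral hhi (Eventually.of_forall fun k => by positivity)
    have h2 : ∫ k, (1 + g k ^ 2) / 2 ∂(gaussianReal 0 T.toNNReal) =
        (1 + ∫ k, g k ^ 2 ∂(gaussianReal 0 T.toNNReal)) / 2 := by
      rw [integral_div, integral_add (integrable_const _) hg2, integral_const]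
      simp
    linarith
  have hconst : ∀ (S : Set ℝ) (c : ℝ), ∫ _ in S, c ∂(gaussianReal 0 T.toNNReal) =
      c * (gaussianReal 0 T.toNNReal).real S := by
    intro S c; rw [setIntegral_const, smul_eq_mul, mul_comm]
  -- upper side on `[√T, 2√T]`
  have h_up : g (Real.sqrt T) * (gaussianReal 0 T.toNNReal).real (Icc (Real.sqrt T) (2 * Real.sqrt T)) ≤
      (1 + ∫ k, g k ^ 2 ∂(gaussianReal 0 T.toNNReal)) / 2 := by
    have h1 : g (Real.sqrt T) * (gaussianReal 0 T.toNNReal).real (Icc (Real.sqrt T) (2 * Real.sqrt T)) ≤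
        ∫ k in Icc (Real.sqrt T) (2 * Real.sqrt T), g k ∂(gaussianReal 0 T.toNNReal) := by
      rw [← hconst]
      refine setIntegral_mono_on (integrable_const _).integrableOn hgi.integrableOn measurableSet_Icc ?_
      intro k hk
      refine hmono _ _ ?_ ?_
      · rw [hsT2]; nlinarith [hk.1, hsT]
      · nlinarith [hk.1, hk.2, hsT, hsT2]
    have h2 : ∫ k in Icc (Real.sqrt T) (2 * Real.sqrt T), g k ∂(gaussianReal 0 T.toNNReal) ≤
        ∫ k in Icc (Real.sqrt T) (2 * Real.sqrt T), (1 + g k ^ 2) / 2 ∂(gaussianReal 0 T.toNNReal) :=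
      setIntegral_mono_on hgi.integrableOn hhi.integrableOn measurableSet_Icc (fun k _ => hhalf k)
    linarith [hset (Icc (Real.sqrt T) (2 * Real.sqrt T))]
  -- lower side on `[0, √T]`
  have h_lo : -g (Real.sqrt T) * (gaussianReal 0 T.toNNReal).real (Icc 0 (Real.sqrt T)) ≤
      (1 + ∫ k, g k ^ 2 ∂(gaussianReal 0 T.toNNReal)) / 2 := by
    have h1 : -g (Real.sqrt T) * (gaussianReal 0 T.toNNReal).real (Icc 0 (Real.sqrt T)) ≤
        ∫ k in Icc 0 (Real.sqrt T), -g k ∂(gaussianReal 0 T.toNNReal) := by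
      rw [← hconst]
      refine setIntegral_mono_on (integrable_const _).integrableOn hgi.neg.integrableOn measurableSet_Icc ?_
      intro k hk
      have : g k ≤ g (Real.sqrt T) := by
        refine hmono _ _ ?_ ?_
        · rw [hsT2]; nlinarith [hk.1, hk.2, hsT]
        · rw [hsT2]; linarith
      linarith
    have h2 : ∫ k in Icc 0 (Real.sqrt T), -g k ∂(gaussianReal 0 T.toNNReal) ≤
        ∫ k in Icc 0 (Real.sqrt T), (1 + g k ^ 2) / 2 ∂(gaussianReal 0 T.toNNReal) :=
      setIntegral_mono_on hgi.neg.integrableOn hhi.integrableOn measurableSet_Icc (fun k _ => hhalf' k)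
    linarith [hset (Icc 0 (Real.sqrt T))]
  have hw_up : gaussTWindow T ≤ (gaussianReal 0 T.toNNReal).real (Icc (Real.sqrt T) (2 * Real.sqrt T)) :=
    min_le_left _ _
  have hw_lo : gaussTWindow T ≤ (gaussianReal 0 T.toNNReal).real (Icc 0 (Real.sqrt T)) := min_le_right _ _
  rcases le_or_gt 0 (g (Real.sqrt T)) with h | h
  · rw [abs_of_nonneg h]; nlinarith
  · rw [abs_of_neg h]; nlinarith

/-- The outer pointwise estimate of the confinement lemma (pure real algebra): with `K = κ² ≤ x = k²`, `θ = k² − T`,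
`|θ| ≤ x + T`, `|A| ≤ aB`:  `|θ|·|G − A| ≤ K^{−j}·(θ²x^{2j}/2 + G²/2 + aB·(x+T)·x^j)`. [this cell] -/
theorem outer_pointwise_bound {K x θ G A aB T : ℝ} (j : ℕ) (hK : 0 < K) (hKx : K ≤ x) (hθ : |θ| ≤ x + T)
    (hA : |A| ≤ aB) :
    |θ| * |G - A| ≤ K⁻¹ ^ j * (θ ^ 2 * x ^ (2 * j) / 2 + G ^ 2 / 2 + aB * ((x + T) * x ^ j)) := by
  have hx : 0 ≤ x := hK.le.trans hKx
  have haB : 0 ≤ aB := (abs_nonneg A).trans hA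
  have hpow : ∀ i : ℕ, K ^ i ≤ x ^ i := fun i => pow_le_pow_left₀ hK.le hKx i
  have hKj : 0 < K ^ j := pow_pos hK j
  have hKij : 0 ≤ K⁻¹ ^ j := pow_nonneg (inv_nonneg.2 hK.le) j
  -- AM–GM with weight `K^j`
  have h1 : |θ| * |G| ≤ (K ^ j * θ ^ 2 + G ^ 2 / K ^ j) / 2 := abs_mul_abs_le_weighted hKj
  have h1' : G ^ 2 / K ^ j = K⁻¹ ^ j * G ^ 2 := by rw [inv_pow, div_eq_inv_mul]
  have hKK : K⁻¹ ^ j * K ^ j = 1 := by rw [← mul_pow, inv_mul_cancel₀ hK.ne', one_pow]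
  have h2 : K ^ j * θ ^ 2 ≤ K⁻¹ ^ j * (θ ^ 2 * x ^ (2 * j)) := by
    have e : K ^ j * θ ^ 2 = K⁻¹ ^ j * (θ ^ 2 * K ^ (2 * j)) := by
      rw [two_mul, pow_add, show K⁻¹ ^ j * (θ ^ 2 * (K ^ j * K ^ j)) = (K⁻¹ ^ j * K ^ j) * (K ^ j * θ ^ 2) by ring,
        hKK, one_mul]
    rw [e]
    exact mul_le_mul_of_nonneg_left (mul_le_mul_of_nonneg_left (hpow _) (sq_nonneg _)) hKij
  have hxT : 0 ≤ x + T := (abs_nonneg θ).trans hθ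
  have h3 : |θ| * |A| ≤ K⁻¹ ^ j * (aB * ((x + T) * x ^ j)) := by
    have e : |θ| = K⁻¹ ^ j * (K ^ j * |θ|) := by
      rw [← mul_assoc, hKK, one_mul]
    rw [e]
    have h4 : |A| * (|θ| * K ^ j) ≤ aB * ((x + T) * x ^ j) :=
      mul_le_mul hA (mul_le_mul hθ (hpow j) hKj.le hxT) (by positivity) haB
    calc K⁻¹ ^ j * (K ^ j * |θ|) * |A| = K⁻¹ ^ j * (|A| * (|θ| * K ^ j)) := by ring
      _ ≤ K⁻¹ ^ j * (aB * ((x + T) * x ^ j)) := mul_le_mul_of_nonneg_left h4 hKij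
  calc |θ| * |G - A| ≤ |θ| * (|G| + |A|) := by gcongr; exact abs_sub _ _
    _ = |θ| * |G| + |θ| * |A| := by ring
    _ ≤ (K ^ j * θ ^ 2 + G ^ 2 / K ^ j) / 2 + K⁻¹ ^ j * (aB * ((x + T) * x ^ j)) := add_le_add h1 h3
    _ ≤ K⁻¹ ^ j * (θ ^ 2 * x ^ (2 * j) / 2 + G ^ 2 / 2 + aB * ((x + T) * x ^ j)) := by
        rw [h1']; nlinarith [h2]

/-- ★★ **THE CONFINEMENT LEMMA (Gaussian cheapness of hard kicks).**  For `T > 0` and `j ∈ ℕ` there is `A = A(T,j) ≥ 0` such that for every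
confinement radius `κ` with `κ² ≥ 4T` and every `g ∈ L²(ν_T)` that is NONDECREASING IN `k²` ON THE CONFINED RANGE `k² ≤ κ²` only,

  `𝔇_T(g) ≤ A · (κ²)^{−j} · (1 + ‖g‖²_{L²(ν_T)})`.

Mechanism: the comparison curve `R = g` on `k² ≤ κ²`, `R ≡ g(√T)` outside, is single-crossing-admissible for `thermalCrossDefect_le`; the outer
cost `∫_{k²>κ²} |k²−T|·|g − g(√T)| dν_T` is controlled by `‖g‖₂` (crossing level via `abs_crossLevel_mul_window_le`, weighted AM–GM) and by
Chebyshev with the Gaussian moments, which gives the factor `(κ²)^{−j}` for every `j`. [this cell; NEW] -/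
theorem thermalCrossDefect_le_of_monotoneSqOn {T : ℝ} (hT : 0 < T) (j : ℕ) :
    ∃ A : ℝ, 0 ≤ A ∧ ∀ (κ : ℝ) (g : ℝ → ℝ), 4 * T ≤ κ ^ 2 →
      AEStronglyMeasurable g (gaussianReal 0 T.toNNReal) →
      Integrable (fun k => g k ^ 2) (gaussianReal 0 T.toNNReal) →
      (∀ k₁ k₂ : ℝ, k₁ ^ 2 ≤ k₂ ^ 2 → k₂ ^ 2 ≤ κ ^ 2 → g k₁ ≤ g k₂) →
      thermalCrossDefect T g ≤ A * (κ ^ 2)⁻¹ ^ j * (1 + ∫ k, g k ^ 2 ∂(gaussianReal 0 T.toNNReal)) := by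
  obtain ⟨hM1i, hM2i⟩ := gaussT_integrable_confinementMoments T j
  obtain ⟨M₁, hM1⟩ : ∃ M : ℝ, M = ∫ k, (k ^ 2 - T) ^ 2 * (k ^ 2) ^ (2 * j) ∂(gaussianReal 0 T.toNNReal) := ⟨_, rfl⟩
  obtain ⟨M₂, hM2⟩ : ∃ M : ℝ, M = ∫ k, (k ^ 2 + T) * (k ^ 2) ^ j ∂(gaussianReal 0 T.toNNReal) := ⟨_, rfl⟩
  have hM10 : 0 ≤ M₁ := hM1 ▸ integral_nonneg fun k => by positivity
  have hM20 : 0 ≤ M₂ := hM2 ▸ integral_nonneg fun k => by positivity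
  have hsT2 : Real.sqrt T ^ 2 = T := Real.sq_sqrt hT.le
  have hp0 := gaussTWindow_pos hT
  obtain ⟨p, hp⟩ : ∃ p : ℝ, p = gaussTWindow T := ⟨_, rfl⟩
  rw [← hp] at hp0
  refine ⟨M₁ / 2 + 1 / 2 + M₂ / (2 * p), by positivity, ?_⟩
  intro κ g hκ hgm hg2 hmono
  have hκ0 : 0 < κ ^ 2 := lt_of_lt_of_le (by positivity) hκ
  obtain ⟨I, hI⟩ : ∃ I : ℝ, I = ∫ k, g k ^ 2 ∂(gaussianReal 0 T.toNNReal) := ⟨_, rfl⟩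
  have hI0 : 0 ≤ I := hI ▸ integral_nonneg fun k => sq_nonneg _
  obtain ⟨a, ha⟩ : ∃ a : ℝ, a = g (Real.sqrt T) := ⟨_, rfl⟩
  -- (1) the crossing level
  obtain ⟨aB, haB⟩ : ∃ aB : ℝ, aB = (1 + I) / (2 * p) := ⟨_, rfl⟩
  have habs : |a| ≤ aB := by
    have h := abs_crossLevel_mul_window_le hT hκ hgm hg2 hmono
    rw [← hp, ← hI, ← ha] at h
    rw [haB, le_div_iff₀ (by positivity)]; linarith
  have haB0 : 0 ≤ aB := (abs_nonneg a).trans habs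
  -- (2) the comparison curve
  obtain ⟨R, hR⟩ : ∃ R : ℝ → ℝ, R = fun k => if k ^ 2 ≤ κ ^ 2 then g k else a := ⟨_, rfl⟩
  have hSi : MeasurableSet {k : ℝ | k ^ 2 ≤ κ ^ 2} := measurableSet_le (measurable_id.pow_const 2) measurable_const
  have hadm : ∀ k : ℝ, 0 ≤ (k ^ 2 - T) * (R k - (a + 0 * k)) := by
    intro k
    rw [hR]; simp only [zero_mul, add_zero]
    split_ifs with hk
    · rcases le_or_gt T (k ^ 2) with hTk | hTk
      · have : a ≤ g k := ha ▸ hmono _ _ (by rw [hsT2]; exact hTk) hk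
        exact mul_nonneg (by linarith) (by linarith)
      · have : g k ≤ a := ha ▸ hmono _ _ (by rw [hsT2]; exact hTk.le) (by rw [hsT2]; linarith)
        exact mul_nonneg_of_nonpos_of_nonpos (by linarith) (by linarith)
    · simp
  have hθ2 : Integrable (fun k : ℝ => (k ^ 2 - T) ^ 2) (gaussianReal 0 T.toNNReal) := by
    have e : (fun k : ℝ => (k ^ 2 - T) ^ 2) = fun k => (k ^ 4 - 2 * T * k ^ 2) + T ^ 2 * k ^ 0 := by
      funext k; ring
    rw [e]
    have h1 : Integrable (fun k : ℝ => k ^ 4 - 2 * T * k ^ 2) (gaussianReal 0 T.toNNReal) :=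
      (gaussT_integrable_pow' T 4).sub ((gaussT_integrable_pow' T 2).const_mul _)
    exact h1.add ((gaussT_integrable_pow' T 0).const_mul _)
  have hθm : AEStronglyMeasurable (fun k : ℝ => k ^ 2 - T) (gaussianReal 0 T.toNNReal) := by fun_prop
  have hθg : Integrable (fun k : ℝ => (k ^ 2 - T) * g k) (gaussianReal 0 T.toNNReal) :=
    integrable_mul_of_sq_sq hθm hgm hθ2 hg2
  have hθa : Integrable (fun k : ℝ => a * (k ^ 2 - T)) (gaussianReal 0 T.toNNReal) :=
    (gaussT_integrable_sqSub T).const_mul a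
  have hRint : Integrable (fun k => (k ^ 2 - T) * R k) (gaussianReal 0 T.toNNReal) := by
    have h := (hθg.indicator hSi).add (hθa.indicator hSi.compl)
    refine h.congr (Eventually.of_forall fun k => ?_)
    rw [hR]; simp only [Pi.add_apply, indicator, mem_setOf_eq, mem_compl_iff]
    split_ifs <;> ring
  have hD := thermalCrossDefect_le (g := g) hadm hRint
  -- (3) the pointwise outer bound
  obtain ⟨Φ, hΦ⟩ : ∃ Φ : ℝ → ℝ, Φ = fun k => (κ ^ 2)⁻¹ ^ j * (((k ^ 2 - T) ^ 2 * (k ^ 2) ^ (2 * j)) / 2 +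
      g k ^ 2 / 2 + aB * ((k ^ 2 + T) * (k ^ 2) ^ j)) := ⟨_, rfl⟩
  have hΦi : Integrable Φ (gaussianReal 0 T.toNNReal) := by
    rw [hΦ]; exact (((hM1i.div_const 2).add (hg2.div_const 2)).add (hM2i.const_mul aB)).const_mul _
  have hpt : ∀ k, |k ^ 2 - T| * |g k - R k| ≤ Φ k := by
    intro k
    by_cases hk : k ^ 2 ≤ κ ^ 2
    · have hRk : R k = g k := by rw [hR]; exact if_pos hk
      have hΦ0 : 0 ≤ Φ k := by rw [hΦ]; positivity
      rw [hRk, sub_self, abs_zero, mul_zero]; exact hΦ0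
    · have hRk : R k = a := by rw [hR]; exact if_neg hk
      have hθ : |k ^ 2 - T| ≤ k ^ 2 + T := by
        rw [abs_le]; constructor <;> nlinarith [sq_nonneg k, hT]
      rw [hRk, hΦ]
      exact outer_pointwise_bound j hκ0 (not_le.1 hk).le hθ habs
  -- (4) integrate
  have hint : ∫ k, |k ^ 2 - T| * |g k - R k| ∂(gaussianReal 0 T.toNNReal) ≤ ∫ k, Φ k ∂(gaussianReal 0 T.toNNReal) :=
    integral_mono_of_nonneg (Eventually.of_forall fun k => by positivity) hΦi (Eventually.of_forall hpt)
  have hΦv : ∫ k, Φ k ∂(gaussianReal 0 T.toNNReal) = (κ ^ 2)⁻¹ ^ j * (M₁ / 2 + I / 2 + aB * M₂) := by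
    have i3 : Integrable (fun k : ℝ => (k ^ 2 - T) ^ 2 * (k ^ 2) ^ (2 * j) / 2) (gaussianReal 0 T.toNNReal) :=
      hM1i.div_const 2
    have i4 : Integrable (fun k : ℝ => g k ^ 2 / 2) (gaussianReal 0 T.toNNReal) := hg2.div_const 2
    have i1 : Integrable (fun k : ℝ => (k ^ 2 - T) ^ 2 * (k ^ 2) ^ (2 * j) / 2 + g k ^ 2 / 2) (gaussianReal 0 T.toNNReal) :=
      i3.add i4
    have i2 : Integrable (fun k : ℝ => aB * ((k ^ 2 + T) * (k ^ 2) ^ j)) (gaussianReal 0 T.toNNReal) :=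
      hM2i.const_mul aB
    rw [hΦ, integral_const_mul, integral_add i1 i2, integral_add i3 i4, integral_div, integral_div, integral_const_mul,
      ← hM1, ← hM2, ← hI]
  have hfin : (κ ^ 2)⁻¹ ^ j * (M₁ / 2 + I / 2 + aB * M₂) ≤ (M₁ / 2 + 1 / 2 + M₂ / (2 * p)) * (κ ^ 2)⁻¹ ^ j * (1 + I) := by
    have hρj : 0 ≤ (κ ^ 2)⁻¹ ^ j := pow_nonneg (inv_nonneg.2 hκ0.le) _
    have h1 : M₁ / 2 + I / 2 + aB * M₂ ≤ (M₁ / 2 + 1 / 2 + M₂ / (2 * p)) * (1 + I) := by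
      rw [haB]
      have e : (1 + I) / (2 * p) * M₂ = M₂ / (2 * p) * (1 + I) := by ring
      rw [e]
      nlinarith [mul_nonneg hI0 hM10, div_nonneg hM20 (by positivity : (0:ℝ) ≤ 2 * p)]
    calc (κ ^ 2)⁻¹ ^ j * (M₁ / 2 + I / 2 + aB * M₂) ≤ (κ ^ 2)⁻¹ ^ j * ((M₁ / 2 + 1 / 2 + M₂ / (2 * p)) * (1 + I)) :=
          mul_le_mul_of_nonneg_left h1 hρj
      _ = _ := by ring
  calc thermalCrossDefect T g ≤ ∫ k, |k ^ 2 - T| * |g k - R k| ∂(gaussianReal 0 T.toNNReal) := hD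
    _ ≤ ∫ k, Φ k ∂(gaussianReal 0 T.toNNReal) := hint
    _ = (κ ^ 2)⁻¹ ^ j * (M₁ / 2 + I / 2 + aB * M₂) := hΦv
    _ ≤ (M₁ / 2 + 1 / 2 + M₂ / (2 * p)) * (κ ^ 2)⁻¹ ^ j * (1 + I) := hfin
    _ = (M₁ / 2 + 1 / 2 + M₂ / (2 * p)) * (κ ^ 2)⁻¹ ^ j * (1 + ∫ k, g k ^ 2 ∂(gaussianReal 0 T.toNNReal)) := by
        rw [hI]

end Summit.AtomisticToContinuum.FouriersLaw.Theorems.BoundedResponse.HeatSpreading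

end
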